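import Summits.QuantumFields.YangMills.Theorems.FluctuationComparisonRegPrIntLS2BetaLaplacePeano
import Summits.QuantumFields.YangMills.Theorems.FluctuationComparisonRegPrIntLS2BetaCriticalFamily
import Mathlib.Analysis.InnerProductSpace.PiL2
import Mathlib.LinearAlgebra.Determinant
import HarnessLib

/-!
# S2β · LAPLACE row — (L3′): THE BOUND PEANO OPERATOR, and its two BINDING IDENTITIES (slice second derivative; determinant in an orthonormal basis) (pen w5-20520 g14)

Cell `ym3-torus` (rung R3: continuum `SU(2)` Yang–Mills on `T³` — NOT `d = 4`, NOT infinite volume, NOT a mass gap, NOT Clay); width seat `ym-ust-20520-w5` g14;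
helper of the crux `stmt-QuantumFields-20520` (`--supports`, NOT a proof of it).  THEOREMS ONLY (0 `def`, 0 `sorry`; default heartbeats); generic.

WHY (FOUR-POINT-DECAY of LINE g18-1 v10.1; LINE-OWNER RULING (W3)(2): v11 = DET-REP-A must BIND the Laplace exponent's operator to an object of record so that
px19's degenerate witness (`ι := Unit`, `M := 1`) cannot re-enter).  w4's ✓(L3) `…LaplacePeano.hessianRows_of_contDiffAt_of_growth` returns `∃ Ah` — unbound.
THIS FILE names it: `Ah := InnerProductSpace.continuousLinearMapOfBilin (fderiv ℝ (fderiv ℝ φ) 0)` (the Riesz representative of `D²φ(0)`), proves the same three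
rows for THIS operator plus `⟪Ah y, z⟫ = D²φ(0) y z`, and supplies the two identities that tie it to the (DET) matrix of ✓`…HessianDetRows.sliceHessian_detRows`:
the slice second derivative `D²(v ↦ f(s, e₀ + v))(0) v w` IS the slice Hessian `((D[q ↦ Df(q) ∘ inr](s, e₀)) ∘ inr) v w`, and `det Ah = det (B (b i) (b j))ᵢⱼ`
for any orthonormal basis `b` — so `√det Ah` in the corner constant of ✓(CT-dock) is `√det M(s,t)` of the (DET) rows.

HONEST SCOPE.  Calculus ∕ linear-algebra glue; proves no stub; FOUR-POINT-DECAY ∕ LAPLACE ∕ S2β ∕ the crux 20520 NOT proved; `YM3TorusSU2` NOT proved; the Yang–Mills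
mass gap (Clay) NOT proved.

References: [Breitung1994] LNM 1592, Thm 41 p. 56 and Lemma 40 p. 55; [Balaban1985Variational] CMP 102 (1985) (142) p. 299; [Dieudonne1960] Ch. X §2 (10.2.3).
-/

noncomputable section

open Filter Topology Asymptotics Set Function
open scoped InnerProductSpace Matrix
open Literature.Analysis.Asymptotics
open Summit.QuantumFields.YangMills.Theorems.FluctuationComparisonRegPrIntLS2BetaLaplaceLimit (inner_pos_of_quadratic_growth)
open Summit.QuantumFields.YangMills.Theorems.FluctuationComparisonRegPrIntLS2BetaCriticalFamily (contDiffAt_partialFDeriv fderiv_slice_eq_comp_inr)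

namespace Summit.QuantumFields.YangMills.Theorems.FluctuationComparisonRegPrIntLS2BetaBoundPeano

variable {Vt : Type*} [NormedAddCommGroup Vt] [InnerProductSpace ℝ Vt] [CompleteSpace Vt]

/-! ## §1 The bound Peano operator -/

/-- ★★ **(L3′) THE BOUND PEANO OPERATOR.**  `φ : Vt → ℝ` `C²` at `0` with `φ y − φ 0 ≥ c‖y‖²` near `0` (`c > 0`).  The NAMED operator
`Ah := continuousLinearMapOfBilin (D²φ(0))` satisfies: `⟪Ah y, z⟫ = D²φ(0) y z`; `Ah` is symmetric; `⟪Ah y, y⟫ > 0` for `y ≠ 0`; `φ y − φ 0 − ½⟪Ah y, y⟫ = o(‖y‖²)`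
— w4's ✓`hessianRows_of_contDiffAt_of_growth` with the witness exposed. [cite: Breitung1994, Thm 41 p. 56 and Lemma 40 p. 55] [cite: Balaban1985Variational, (142) p. 299] -/
theorem boundPeano_rows {φ : Vt → ℝ} (hφ : ContDiffAt ℝ 2 φ 0) {c : ℝ} (hc : 0 < c)
    (hgrow : ∀ᶠ y in 𝓝 (0 : Vt), c * ‖y‖ ^ 2 ≤ φ y - φ 0) :
    (∀ y z, ⟪(InnerProductSpace.continuousLinearMapOfBilin (𝕜 := ℝ) (fderiv ℝ (fderiv ℝ φ) 0) : Vt →L[ℝ] Vt) y, z⟫_ℝ = fderiv ℝ (fderiv ℝ φ) 0 y z) ∧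
    ((InnerProductSpace.continuousLinearMapOfBilin (𝕜 := ℝ) (fderiv ℝ (fderiv ℝ φ) 0) : Vt →L[ℝ] Vt) : Vt →ₗ[ℝ] Vt).IsSymmetric ∧
    (∀ y, y ≠ 0 → 0 < ⟪(InnerProductSpace.continuousLinearMapOfBilin (𝕜 := ℝ) (fderiv ℝ (fderiv ℝ φ) 0) : Vt →L[ℝ] Vt) y, y⟫_ℝ) ∧
    ((fun y => φ y - φ 0 - (1 / 2) * ⟪(InnerProductSpace.continuousLinearMapOfBilin (𝕜 := ℝ) (fderiv ℝ (fderiv ℝ φ) 0) : Vt →L[ℝ] Vt) y, y⟫_ℝ)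
      =o[𝓝 0] fun y => ‖y‖ ^ 2) := by
  obtain ⟨hS1, hS2⟩ := hasFDerivAt_data_of_contDiffAt_two hφ
  set S'' : Vt →L[ℝ] Vt →L[ℝ] ℝ := fderiv ℝ (fderiv ℝ φ) 0 with hS''
  set A : Vt →L[ℝ] Vt := InnerProductSpace.continuousLinearMapOfBilin (𝕜 := ℝ) S'' with hAdef
  have hsymm : ∀ v w, S'' v w = S'' w v := second_derivative_symmetric_of_eventually_of_real hS1 hS2
  have hAS' : ∀ y z, ⟪A y, z⟫_ℝ = S'' y z := fun y z => by
    rw [hAdef, InnerProductSpace.continuousLinearMapOfBilin_apply]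
  have hA : (A : Vt →ₗ[ℝ] Vt).IsSymmetric := fun y z => by
    rw [ContinuousLinearMap.coe_coe, hAS', hsymm, ← hAS', real_inner_comm]
  have hmin : IsLocalMin φ 0 := by
    filter_upwards [hgrow] with y hy
    nlinarith [sq_nonneg ‖y‖, hc.le]
  have hcrit : fderiv ℝ φ 0 = 0 := hmin.fderiv_eq_zero
  have hPeano : (fun y => φ y - φ 0 - (1 / 2) * ⟪A y, y⟫_ℝ) =o[𝓝 0] fun y => ‖y‖ ^ 2 := by
    have h := isLittleO_taylor_two hS1 hS2
    refine (h.congr' (Eventually.of_forall fun x => ?_) (Eventually.of_forall fun x => ?_))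
    · simp only [hcrit, zero_apply, sub_zero, hAS']
    · simp only [sub_zero]
  have hposA : ∀ y, y ≠ 0 → 0 < ⟪(A : Vt →ₗ[ℝ] Vt) y, y⟫_ℝ := inner_pos_of_quadratic_growth hc hgrow hPeano
  exact ⟨hAS', hA, fun y hy => hposA y hy, hPeano⟩

/-! ## §2 Binding identity I: the slice second derivative is the slice Hessian -/

/-- ★ **THE SLICE SECOND DERIVATIVE IS THE SLICE HESSIAN.**  For `f : S × E → ℝ` of class `C²` at `(s, e₀)`:
`D²(v ↦ f(s, e₀ + v))(0) v w = ((D[q ↦ Df(q) ∘ inr](s, e₀)) ∘ inr) v w` — the operator of §1 for `φ := v ↦ f(s, e₀ + v)` is the slice Hessian of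
✓`…HessianDetRows.sliceHessian_detRows` at `(s, e₀)`. [cite: Dieudonne1960, Ch. X §2 (10.2.3) (bookkeeping)] -/
theorem fderiv_fderiv_slice_eq {S E : Type*} [NormedAddCommGroup S] [NormedSpace ℝ S] [NormedAddCommGroup E] [NormedSpace ℝ E]
    {f : S × E → ℝ} {s : S} {e₀ : E} (hf : ContDiffAt ℝ 2 f (s, e₀)) (v w : E) :
    fderiv ℝ (fderiv ℝ (fun x : E => f (s, e₀ + x))) 0 v w =
      ((fderiv ℝ (fun q : S × E => (fderiv ℝ f q).comp (ContinuousLinearMap.inr ℝ S E)) (s, e₀)).comp (ContinuousLinearMap.inr ℝ S E)) v w := by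
  set Φ : S × E → E →L[ℝ] ℝ := fun q => (fderiv ℝ f q).comp (ContinuousLinearMap.inr ℝ S E) with hΦ
  set τ : E → S × E := fun x => ((s, e₀) : S × E) + ContinuousLinearMap.inr ℝ S E x with hτ
  have hτx : ∀ x, τ x = (s, e₀ + x) := fun x => by simp [hτ]
  have hψ : (fun x : E => f (s, e₀ + x)) = f ∘ τ := by funext x; simp [Function.comp, hτx]
  have hτd : ∀ x, HasFDerivAt τ (ContinuousLinearMap.inr ℝ S E) x := fun x =>
    ((ContinuousLinearMap.inr ℝ S E).hasFDerivAt).const_add ((s, e₀) : S × E)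
  have hτ0 : τ 0 = (s, e₀) := by rw [hτx, add_zero]
  -- `f` is differentiable near `(s, e₀)`, hence near `τ x` for `x` near `0`
  have hdiff : ∀ᶠ q in 𝓝 ((s : S), e₀), DifferentiableAt ℝ f q :=
    ((hf.of_le (by norm_num : (1 : WithTop ℕ∞) ≤ 2)).eventually (by simp)).mono fun q hq => hq.differentiableAt one_ne_zero
  have hτc : Tendsto τ (𝓝 0) (𝓝 (s, e₀)) := by rw [← hτ0]; exact (hτd 0).continuousAt
  have hev : fderiv ℝ (fun x : E => f (s, e₀ + x)) =ᶠ[𝓝 0] fun x => Φ (τ x) := by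
    filter_upwards [hτc.eventually hdiff] with x hx
    rw [hψ]
    exact (hx.hasFDerivAt.comp x (hτd x)).fderiv
  rw [hev.fderiv_eq]
  have hΦd : DifferentiableAt ℝ Φ (τ 0) := by
    rw [hτ0]
    have hf11 : ContDiffAt ℝ (1 + 1) f (s, e₀) := hf.of_le (by norm_num)
    exact (contDiffAt_partialFDeriv (n := 1) hf11).differentiableAt one_ne_zero
  show fderiv ℝ (Φ ∘ τ) 0 v w = _
  rw [fderiv_comp 0 hΦd (hτd 0).differentiableAt, (hτd 0).fderiv, hτ0]

/-! ## §3 Binding identity II: the determinant in an orthonormal basis -/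

/-- ★ **`det` OF THE RIESZ REPRESENTATIVE = `det` OF THE MATRIX OF THE FORM IN AN ORTHONORMAL BASIS.**  For a continuous bilinear form `B` on a finite-dimensional
real inner-product space and an orthonormal basis `b`: `det (continuousLinearMapOfBilin B) = det (B (b i) (b j))ᵢⱼ`.  (With §1–§2: the Laplace exponent's `det Ah`
at a corner IS `det M(s,t)` of the (DET) rows.) [cite: Breitung1994, Thm 41 p. 56 (the determinant in the constant)] -/
theorem det_clmOfBilin_eq_det_matrix [FiniteDimensional ℝ Vt] {ι : Type*} [Fintype ι] [DecidableEq ι] (b : OrthonormalBasis ι ℝ Vt)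
    (B : Vt →L[ℝ] Vt →L[ℝ] ℝ) :
    LinearMap.det ((InnerProductSpace.continuousLinearMapOfBilin (𝕜 := ℝ) B : Vt →L[ℝ] Vt) : Vt →ₗ[ℝ] Vt) =
      (Matrix.of fun i j => B (b i) (b j)).det := by
  set A : Vt →L[ℝ] Vt := InnerProductSpace.continuousLinearMapOfBilin (𝕜 := ℝ) B with hAdef
  have hAB : ∀ y z, ⟪A y, z⟫_ℝ = B y z := fun y z => by rw [hAdef, InnerProductSpace.continuousLinearMapOfBilin_apply]
  have hM : LinearMap.toMatrix b.toBasis b.toBasis (A : Vt →ₗ[ℝ] Vt) = (Matrix.of fun i j => B (b i) (b j))ᵀ := by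
    ext i j
    rw [LinearMap.toMatrix_apply, OrthonormalBasis.coe_toBasis_repr_apply, OrthonormalBasis.repr_apply_apply, OrthonormalBasis.coe_toBasis,
      Matrix.transpose_apply, Matrix.of_apply, ContinuousLinearMap.coe_coe, real_inner_comm, hAB]
  rw [← LinearMap.det_toMatrix b.toBasis, hM, Matrix.det_transpose]

end Summit.QuantumFields.YangMills.Theorems.FluctuationComparisonRegPrIntLS2BetaBoundPeano

end
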